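import Summits.ResolutionOfSingularities.ResolutionOfSingularities.Theorems.MarkedTransferCampaignW46ThreefoldsGammaFreeGlobalLadder
import Literature.AlgebraicGeometry.Resolution.NearPointsPointCentre
import Literature.AlgebraicGeometry.Resolution.NearPointsCurveCentre
import Literature.AlgebraicGeometry.Resolution.BlowupOffCentre
import Literature.AlgebraicGeometry.Resolution.BlowupsExistence
import Literature.AlgebraicGeometry.Resolution.RegularSystemOfParameters
import HarnessLib

/-!
# [OURS · L1 W4.6 rung (ii-τ)] THE NO-NEAR-POINT SLICE AT d = 3 — an equimultiple regular centre carrying the whole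
# order-`m` locus, made of threefold POINTS with `τ = 3` and regular CURVE points with `τ ≥ 2`, is resolved by ONE blowing
# up, PROVED (Cossart–Piltant 2008 Lemma 4.3 (1)+(2), tree, in the campaign's words)

Cell res-hironaka, LADDER-RESOLUTION rung L (D-0089), slot W4.6, rung (ii) (threefold hypersurfaces) in the DIMENSION
LADDER of the Γ-free statement (`CampaignW46.OrderReducible`, p496755). Seat res-L1-s46-pv-3 (gen 3). Host route
MarkedTransfer, host item `HypersurfaceOrderReductionDimLeThree` (stmt-ResolutionOfSingularities-16156); filed
`--kind proof --supports` it `--as helper`. OURS scheme theory over PROVED tree lemmas (the tree's kernel-checked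
Cossart–Piltant 2008 Lemma 4.3: no point of the blow-up is NEAR a centre point with `τ = 3` (point centre) or `τ ≥ 2`
(curve centre), i.e. the order of the weak transform DROPS there —
`IsBlowup.idealOrder_controlledTransform_lt_of_stalkTau_eq_three` / `…_of_two_le_stalkTau`); nothing of H. Hironaka's
manuscript is asserted. AI-written; AI review is weaker than expert review. Companion of `…ThreefoldsTauThreeSlice.lean`
(finite point centres).

## What is proved (no new definitions)

* `CampaignW46.orderReducible_of_noNearPoints` — **THE NO-NEAR-POINT SLICE.** `X` regular locally Noetherian, `J` an
  ideal sheaf, `m ≥ 1`, `Y ⊆ X` closed with `V(𝓘_Y)` REGULAR, containing every point of order `≥ m` and EQUIMULTIPLE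
  (`ord_y J = m` on `Y`), such that at every `y ∈ Y` EITHER `y` is an isolated threefold point of `Y` with `τ = 3`
  (`(𝓘_Y)_y = 𝔪_y`, embedding dimension `3`, `τ_y(J, m) = 3`) OR `Y` is a curve of embedding codimension `2` at `y` with
  `τ ≥ 2` (`(𝓘_Y)_y = (c₁, c₂)` for a part `c` of a regular system of parameters, `τ_y(J, m) ≥ 2`). Then `(X, J, m)` is
  ORDER-REDUCIBLE, by the single blowing up of `X` along `𝓘_Y`: over `Y` the order of the controlled transform is `< m`
  at every point (no near points), off `Y` it is unchanged.
* `CampaignW46.orderReducible_of_curve_two_le_tau` — the pure curve case (e.g. the equimultiple double line `xz = 0`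
  along the `y`-axis, `τ = 2`: one blow-up of the line resolves it).

HONEST VALUE. With `…TauThreeSlice.lean` this is the «directrix-generic» part of rung (ii) at `d = 3`, characteristic-free:
exactly the inputs at which Hironaka's near-point theorem leaves NOTHING to do after one permissible blowing up. The
content of rung (ii) proper — points with `τ ≤ 2` on point centres, `τ = 1` on curves (where near points survive and the
Moh/kangaroo phenomena live), and positive-dimensional SINGULAR order-`m` loci — is untouched.

References: tree `Resolution/NearPointsPointCentre.lean` [CossartPiltant2008, Lemma 4.3 (1)], `Resolution/NearPointsCurveCentre.lean`
[CossartPiltant2008, Lemma 4.3 (2)], `Resolution/HironakaTauScheme.lean` (`stalkTau`), `Resolution/RsopMonomialIdeals.lean`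
(`IsRsopPart`), `Resolution/BlowupOffCentre.lean` (`IsBlowup.idealOrder_controlledTransform_of_not_mem`),
`Resolution/BlowupsExistence.lean` (`exists_isBlowup` [GortzWedhorn2020, Prop. 13.92]), `Resolution/RegularSystemOfParameters.lean`;
`…GammaFreeGlobalLadder.lean` (p496755). H. Hironaka, ms. 2017-03-23 — scope only, under adjudication, not cited as fact.
[Hironaka2017]
-/

noncomputable section

set_option linter.dupNamespace false -- mandated namespace of this single-conjunct summit

open CategoryTheory AlgebraicGeometry TopologicalSpace IsLocalRing

namespace Summit.ResolutionOfSingularities.ResolutionOfSingularities.Theorems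

namespace CampaignW46

open Literature.AlgebraicGeometry.Resolution
open Scheme.IdealSheafData

universe u

variable {X : Scheme.{u}}

/-- **THE NO-NEAR-POINT SLICE** (see the module docstring): one blowing up along an equimultiple regular centre carrying
the order-`m` locus, whose points are threefold points with `τ = 3` or codimension-`2` curve points with `τ ≥ 2`, reduces
the order below `m` everywhere. [cite: CossartPiltant2008, Lemma 4.3] -/
theorem orderReducible_of_noNearPoints [IsLocallyNoetherian X] (hX : Scheme.IsRegular X) (J : X.IdealSheafData)
    {m : ℕ} (hm : 1 ≤ m) (Y : Closeds X) (hreg : Scheme.IsRegular (vanishingIdeal Y).subscheme)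
    (hJY : ∀ x : X, (m : ℕ∞) ≤ idealOrder J x → x ∈ (Y : Set X)) (hord : ∀ y ∈ (Y : Set X), idealOrder J y = m)
    (hτ : ∀ y ∈ (Y : Set X), haveI := hX y;
      ((maximalIdeal (X.presheaf.stalk y)).spanFinrank = 3 ∧
          stalkIdeal (vanishingIdeal Y) y = maximalIdeal (X.presheaf.stalk y) ∧ stalkTau J y m = 3) ∨
        (∃ c : Fin 2 → X.presheaf.stalk y, IsRsopPart c ∧
          Ideal.span (Set.range c) = stalkIdeal (vanishingIdeal Y) y ∧ 2 ≤ stalkTau J y m)) :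
    OrderReducible J m := by
  have hD : ∀ y ∈ (Y : Set X), (m : ℕ∞) ≤ idealOrder J y := fun y hy => (hord y hy).ge
  obtain ⟨X', π, hπ⟩ := exists_isBlowup X (vanishingIdeal Y)
  haveI : IsProper π := hπ.isProper
  haveI : IsLocallyNoetherian X' := LocallyOfFiniteType.isLocallyNoetherian π
  refine ⟨X', π, controlledTransform π (vanishingIdeal Y) J m, IsPermissibleBlowupSeq.single Y π hreg hD hπ,
    fun x' => ?_⟩
  by_cases hmem : π x' ∈ ((vanishingIdeal Y).support : Set X)
  · rw [coe_support_vanishingIdeal] at hmem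
    haveI := hX (π x')
    rcases hτ (π x') hmem with ⟨hd, hstalk, hτ3⟩ | ⟨c, hcr, hcY, hτ2⟩
    · -- a point centre component with `τ = 3`
      obtain ⟨c₀, hc₀⟩ := exists_regularSystemOfParameters (R := X.presheaf.stalk (π x'))
      let c : Fin 3 → X.presheaf.stalk (π x') := fun i => c₀ (i.cast hd.symm)
      have hrange : Set.range c = Set.range c₀ := by
        ext a
        constructor
        · rintro ⟨i, rfl⟩; exact ⟨i.cast hd.symm, rfl⟩
        · rintro ⟨i, rfl⟩; exact ⟨i.cast hd, by simp [c]⟩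
      have hc : Ideal.span (Set.range c) = maximalIdeal _ := by rw [hrange, hc₀]
      have hcY : Ideal.span (Set.range c) = stalkIdeal (vanishingIdeal Y) (π x') := by rw [hc, hstalk]
      exact hπ.idealOrder_controlledTransform_lt_of_stalkTau_eq_three hX hreg hord hd hc hcY hτ3
    · -- a curve centre component with `τ ≥ 2`
      exact hπ.idealOrder_controlledTransform_lt_of_two_le_stalkTau hX hreg hm hord hcr hcY hτ2
  · rw [hπ.idealOrder_controlledTransform_of_not_mem J m hmem]
    by_contra hge
    rw [not_lt] at hge
    apply hmem
    rw [coe_support_vanishingIdeal]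
    exact hJY _ hge

/-- **The pure curve case**: an equimultiple REGULAR CURVE `Y` of embedding codimension `2` (at each of its points
`(𝓘_Y)_y` is generated by a part `(c₁, c₂)` of a regular system of parameters) carrying the whole order-`m` locus, with
`τ_y(J, m) ≥ 2` everywhere on it, is resolved by one blowing up of `Y` (`m ≥ 1`). Example: the double line `xz` along the
`y`-axis in affine 3-space, `m = 2`. [cite: CossartPiltant2008, Lemma 4.3 (2)] -/
theorem orderReducible_of_curve_two_le_tau [IsLocallyNoetherian X] (hX : Scheme.IsRegular X) (J : X.IdealSheafData)
    {m : ℕ} (hm : 1 ≤ m) (Y : Closeds X) (hreg : Scheme.IsRegular (vanishingIdeal Y).subscheme)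
    (hJY : ∀ x : X, (m : ℕ∞) ≤ idealOrder J x → x ∈ (Y : Set X)) (hord : ∀ y ∈ (Y : Set X), idealOrder J y = m)
    (hcurve : ∀ y ∈ (Y : Set X), haveI := hX y; ∃ c : Fin 2 → X.presheaf.stalk y, IsRsopPart c ∧
      Ideal.span (Set.range c) = stalkIdeal (vanishingIdeal Y) y ∧ 2 ≤ stalkTau J y m) :
    OrderReducible J m :=
  orderReducible_of_noNearPoints hX J hm Y hreg hJY hord fun y hy => Or.inr (hcurve y hy)

end CampaignW46

end Summit.ResolutionOfSingularities.ResolutionOfSingularities.Theorems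

end
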